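import Summits.Parity.GeneralizedHardyLittlewood.Theorems.LeeYangFibresModelHyperbolicityDefs
import HarnessLib

/-!
# Stub `stub_cellLimit` of line `window-chain-transport` for crux `LeeYangFibres.ModelHyperbolicity` (stmt-Parity-14110)

We prove `CellLimitStep : DensityCalculus → CellRate → ∀ u ≥ 2, CellAsymptotics u`: Alladi's cell
asymptotics WITH RATE in the `(X, Y)`-format (`CellRate`, a hypothesis here) imply the LIMIT form
`A_{j+1}(x)·log x/x → I_{j+1}(u)` (`x → ∞` through `ℕ`) at every integer roughness `u ≥ 2`.

Proof (pure real analysis). Put `Y(x) = ⌊x^{1/u}⌋₊ + 1`, so that `cell u x j = omegaCell Y(x) x j`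
(`cell_eq_omegaCell`), and `v(x) = log x/log Y(x)`. For `x ≥ 2`: `x^{1/u} < Y(x) ≤ x^{1/u} + 1 ≤ 2x^{1/u}`,
`2 ≤ Y(x) ≤ x` and `log x = u·log x^{1/u} ≤ u·log Y(x)`, so `CellRate` (with `k = u`) applies at
`(X, Y) = (x, Y(x))`; multiplying its conclusion by `log x/x` gives
`|A_{j+1}(x) log x/x − (I_{j+1}(v(x)) − [j=0]·v(x)·Y(x)/x)| ≤ C·v(x)/log Y(x)`.
Since `log x/u ≤ log Y(x) ≤ log x/u + log 2`, `log Y(x)/log x → 1/u`, hence `v(x) → u`,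
`log Y(x) → ∞` and `Y(x)/x ≤ 2x^{1/u-1} → 0`; continuity of `I_{j+1}` (first conjunct of
`DensityCalculus`) gives `I_{j+1}(v(x)) → I_{j+1}(u)`, and the two error terms tend to `0`.

References: K. Alladi, Quart. J. Math. Oxford (2) 33 (1982) 129–148; G. Tenenbaum, *Introduction to
analytic and probabilistic number theory*, III.6.
-/

noncomputable section

namespace Summit.Parity.GeneralizedHardyLittlewood.Cruxes.ModelHyperbolicity.WindowChainTransport

open scoped BigOperators
open Polynomial Filter
open Summit.Parity.GeneralizedHardyLittlewood.Theorems.ModelHyperbolicity.Negative (cell RealRootedAt)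

/-! ## Helper lemmas: the integer threshold `Y(x) = ⌊x^{1/u}⌋₊ + 1` -/

section Threshold

variable {u : ℕ} {Y : ℕ → ℝ}

/-- `0 ≤ x^{1/u}`. -/
private theorem lim_r_nonneg (u x : ℕ) : (0 : ℝ) ≤ (x : ℝ) ^ ((1 : ℝ) / u) := by positivity

/-- `1 ≤ x^{1/u}` for `x ≥ 1`. -/
private theorem lim_one_le_r (u : ℕ) {x : ℕ} (hx : 1 ≤ x) : (1 : ℝ) ≤ (x : ℝ) ^ ((1 : ℝ) / u) :=
  Real.one_le_rpow (by exact_mod_cast hx) (by positivity)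

/-- `0 < x^{1/u}` for `x ≥ 1`. -/
private theorem lim_r_pos (u : ℕ) {x : ℕ} (hx : 1 ≤ x) : (0 : ℝ) < (x : ℝ) ^ ((1 : ℝ) / u) :=
  Real.rpow_pos_of_pos (by exact_mod_cast hx) _

/-- `x^{1/u} < Y(x)`. -/
private theorem lim_r_lt_Y (hY : ∀ x, Y x = ((⌊(x : ℝ) ^ ((1 : ℝ) / u)⌋₊ + 1 : ℕ) : ℝ)) (x : ℕ) :
    (x : ℝ) ^ ((1 : ℝ) / u) < Y x := by
  rw [hY]; push_cast; exact Nat.lt_floor_add_one _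

/-- `Y(x) ≤ x^{1/u} + 1`. -/
private theorem lim_Y_le (hY : ∀ x, Y x = ((⌊(x : ℝ) ^ ((1 : ℝ) / u)⌋₊ + 1 : ℕ) : ℝ)) (x : ℕ) :
    Y x ≤ (x : ℝ) ^ ((1 : ℝ) / u) + 1 := by
  rw [hY]; push_cast
  linarith [Nat.floor_le (lim_r_nonneg u x)]

/-- `Y(x) ≤ 2 x^{1/u}` for `x ≥ 1`. -/
private theorem lim_Y_le_two_mul (hY : ∀ x, Y x = ((⌊(x : ℝ) ^ ((1 : ℝ) / u)⌋₊ + 1 : ℕ) : ℝ)) {x : ℕ}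
    (hx : 1 ≤ x) : Y x ≤ 2 * (x : ℝ) ^ ((1 : ℝ) / u) := by
  have h1 := lim_Y_le hY x
  have h2 := lim_one_le_r u hx
  linarith

/-- `2 ≤ Y(x)` for `x ≥ 1`. -/
private theorem lim_two_le_Y (hY : ∀ x, Y x = ((⌊(x : ℝ) ^ ((1 : ℝ) / u)⌋₊ + 1 : ℕ) : ℝ)) {x : ℕ}
    (hx : 1 ≤ x) : (2 : ℝ) ≤ Y x := by
  have h1 : 1 ≤ ⌊(x : ℝ) ^ ((1 : ℝ) / u)⌋₊ := (Nat.one_le_floor_iff _).mpr (lim_one_le_r u hx)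
  rw [hY]
  exact_mod_cast (show 2 ≤ ⌊(x : ℝ) ^ ((1 : ℝ) / u)⌋₊ + 1 by omega)

/-- `0 < Y(x)`. -/
private theorem lim_Y_pos (hY : ∀ x, Y x = ((⌊(x : ℝ) ^ ((1 : ℝ) / u)⌋₊ + 1 : ℕ) : ℝ)) (x : ℕ) :
    0 < Y x := by
  rw [hY]; positivity

/-- `Y(x) ≤ x` for `x ≥ 2` and `u ≥ 2`. -/
private theorem lim_Y_le_self (hY : ∀ x, Y x = ((⌊(x : ℝ) ^ ((1 : ℝ) / u)⌋₊ + 1 : ℕ) : ℝ)) (hu : 2 ≤ u)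
    {x : ℕ} (hx : 2 ≤ x) : Y x ≤ x := by
  have hx1 : (1 : ℝ) < x := by exact_mod_cast (show 1 < x by omega)
  have hup : (0 : ℝ) < u := by positivity
  have hexp : (1 : ℝ) / u < 1 := (div_lt_one hup).mpr (by exact_mod_cast (show 1 < u by omega))
  have hlt : (x : ℝ) ^ ((1 : ℝ) / u) < x := Real.rpow_lt_self_of_one_lt hx1 hexp
  have hfl : ⌊(x : ℝ) ^ ((1 : ℝ) / u)⌋₊ < x := (Nat.floor_lt (lim_r_nonneg u x)).mpr hlt
  rw [hY]
  exact_mod_cast (show ⌊(x : ℝ) ^ ((1 : ℝ) / u)⌋₊ + 1 ≤ x by omega)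

/-- `log x = u · log x^{1/u}` for `x ≥ 1`, `u ≠ 0`. -/
private theorem lim_log_eq (hu : u ≠ 0) {x : ℕ} (hx : 1 ≤ x) :
    Real.log x = u * Real.log ((x : ℝ) ^ ((1 : ℝ) / u)) := by
  have hx0 : (0 : ℝ) < x := by exact_mod_cast hx
  have hu0 : (u : ℝ) ≠ 0 := by exact_mod_cast hu
  rw [Real.log_rpow hx0]
  field_simp

/-- `log x ≤ u · log Y(x)` for `x ≥ 1`. -/
private theorem lim_log_le (hY : ∀ x, Y x = ((⌊(x : ℝ) ^ ((1 : ℝ) / u)⌋₊ + 1 : ℕ) : ℝ)) (hu : u ≠ 0)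
    {x : ℕ} (hx : 1 ≤ x) : Real.log x ≤ u * Real.log (Y x) := by
  rw [lim_log_eq hu hx]
  have hr := lim_r_pos u hx
  gcongr
  exact (lim_r_lt_Y hY x).le

/-- `log Y(x) ≤ log x / u + log 2` for `x ≥ 1`. -/
private theorem lim_log_Y_le (hY : ∀ x, Y x = ((⌊(x : ℝ) ^ ((1 : ℝ) / u)⌋₊ + 1 : ℕ) : ℝ))
    {x : ℕ} (hx : 1 ≤ x) : Real.log (Y x) ≤ Real.log x / u + Real.log 2 := by
  have hr := lim_r_pos u hx
  have hx0 : (0 : ℝ) < x := by exact_mod_cast hx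
  have h1 : Real.log (Y x) ≤ Real.log (2 * (x : ℝ) ^ ((1 : ℝ) / u)) :=
    Real.log_le_log (lim_Y_pos hY x) (lim_Y_le_two_mul hY hx)
  rw [Real.log_mul two_ne_zero hr.ne', Real.log_rpow hx0] at h1
  calc Real.log (Y x) ≤ Real.log 2 + 1 / u * Real.log x := h1
    _ = Real.log x / u + Real.log 2 := by ring

/-! ## Helper lemmas: the limits -/

/-- `log x → ∞` along `ℕ`. -/
private theorem lim_tendsto_log : Tendsto (fun x : ℕ => Real.log x) atTop atTop :=
  Real.tendsto_log_atTop.comp tendsto_natCast_atTop_atTop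

/-- `log Y(x) / log x → 1/u`. -/
private theorem lim_tendsto_ratio (hY : ∀ x, Y x = ((⌊(x : ℝ) ^ ((1 : ℝ) / u)⌋₊ + 1 : ℕ) : ℝ))
    (hu : u ≠ 0) : Tendsto (fun x : ℕ => Real.log (Y x) / Real.log x) atTop (nhds (1 / u)) := by
  have hupper : Tendsto (fun x : ℕ => 1 / (u : ℝ) + Real.log 2 / Real.log x) atTop (nhds (1 / u)) := by
    have h : Tendsto (fun x : ℕ => Real.log 2 / Real.log x) atTop (nhds 0) :=
      tendsto_const_nhds.div_atTop lim_tendsto_log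
    simpa using tendsto_const_nhds.add h
  refine tendsto_of_tendsto_of_tendsto_of_le_of_le' tendsto_const_nhds hupper ?_ ?_
  · filter_upwards [eventually_ge_atTop 2] with x hx
    have hL : 0 < Real.log x := Real.log_pos (by exact_mod_cast (show 1 < x by omega))
    have h := lim_log_le hY hu (x := x) (by omega)
    rw [le_div_iff₀ hL]
    calc 1 / u * Real.log x = Real.log x / u := by ring
      _ ≤ u * Real.log (Y x) / u := by gcongr
      _ = Real.log (Y x) := by field_simp
  · filter_upwards [eventually_ge_atTop 2] with x hx
    have hL : 0 < Real.log x := Real.log_pos (by exact_mod_cast (show 1 < x by omega))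
    have h := lim_log_Y_le hY (x := x) (by omega)
    rw [div_le_iff₀ hL, add_mul, div_mul_cancel₀ _ hL.ne']
    calc Real.log (Y x) ≤ Real.log x / u + Real.log 2 := h
      _ = 1 / u * Real.log x + Real.log 2 := by ring

/-- `v(x) = log x / log Y(x) → u`. -/
private theorem lim_tendsto_v (hY : ∀ x, Y x = ((⌊(x : ℝ) ^ ((1 : ℝ) / u)⌋₊ + 1 : ℕ) : ℝ))
    (hu : u ≠ 0) : Tendsto (fun x : ℕ => Real.log x / Real.log (Y x)) atTop (nhds u) := by
  have hu0 : (1 : ℝ) / u ≠ 0 := by positivity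
  have h := (lim_tendsto_ratio hY hu).inv₀ hu0
  rw [one_div, inv_inv] at h
  refine h.congr fun x => ?_
  rw [inv_div]

/-- `log Y(x) → ∞`. -/
private theorem lim_tendsto_logY (hY : ∀ x, Y x = ((⌊(x : ℝ) ^ ((1 : ℝ) / u)⌋₊ + 1 : ℕ) : ℝ))
    (hu : u ≠ 0) : Tendsto (fun x : ℕ => Real.log (Y x)) atTop atTop := by
  have hup : (0 : ℝ) < u := by positivity
  refine tendsto_atTop_mono' atTop ?_ (lim_tendsto_log.atTop_div_const hup)
  filter_upwards [eventually_ge_atTop 1] with x hx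
  rw [div_le_iff₀' hup]
  exact lim_log_le hY hu hx

/-- `Y(x) / x → 0` (here `u ≥ 2` is used: `Y(x) ≤ 2 x^{1/u} = o(x)`). -/
private theorem lim_tendsto_Y_div (hY : ∀ x, Y x = ((⌊(x : ℝ) ^ ((1 : ℝ) / u)⌋₊ + 1 : ℕ) : ℝ))
    (hu : 2 ≤ u) : Tendsto (fun x : ℕ => Y x / x) atTop (nhds 0) := by
  have hup : (0 : ℝ) < u := by positivity
  have h1 : (0 : ℝ) < 1 - 1 / u := by
    rw [sub_pos, div_lt_one hup]
    exact_mod_cast (show 1 < u by omega)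
  have h2 : Tendsto (fun x : ℕ => 2 * (x : ℝ) ^ (1 / (u : ℝ) - 1)) atTop (nhds 0) := by
    have h := ((tendsto_rpow_neg_atTop h1).comp tendsto_natCast_atTop_atTop).const_mul 2
    rw [mul_zero] at h
    refine h.congr fun x => ?_
    simp only [Function.comp_apply, neg_sub]
  refine squeeze_zero' (Eventually.of_forall fun x => ?_) ?_ h2
  · exact div_nonneg (lim_Y_pos hY x).le (Nat.cast_nonneg x)
  · filter_upwards [eventually_ge_atTop 1] with x hx
    have hx0 : (0 : ℝ) < x := by exact_mod_cast hx
    rw [Real.rpow_sub_one hx0.ne', ← mul_div_assoc]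
    gcongr
    exact lim_Y_le_two_mul hY hx

end Threshold

/-! ## The registered stub (name and statement EXACTLY as registered) -/

/-- **The LIMIT step.** Alladi's cell asymptotics with rate (`CellRate`, in the `(X, Y)`-format)
imply the limit form `A_{j+1}(x)·log x/x → I_{j+1}(u)` at every integer roughness `u ≥ 2`
(`CellAsymptotics u`), given the continuity of the densities (first conjunct of
`DensityCalculus`): apply the rate bound at `X = x`, `Y = ⌊x^{1/u}⌋₊ + 1`, `k = u`, multiply by
`log x/x`, and pass to the limit using `log x/log Y → u`. -/
theorem stub_cellLimit : CellLimitStep := by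
  intro hC hR u hu j
  have hu0 : u ≠ 0 := by omega
  obtain ⟨C, hCR⟩ := hR j u
  obtain ⟨Y, hY⟩ : ∃ Y : ℕ → ℝ, ∀ x, Y x = ((⌊(x : ℝ) ^ ((1 : ℝ) / u)⌋₊ + 1 : ℕ) : ℝ) :=
    ⟨_, fun _ => rfl⟩
  have hv : Tendsto (fun x : ℕ => Real.log x / Real.log (Y x)) atTop (nhds u) := lim_tendsto_v hY hu0
  have hM : Tendsto (fun x : ℕ => Real.log (Y x)) atTop atTop := lim_tendsto_logY hY hu0
  have hYx : Tendsto (fun x : ℕ => Y x / x) atTop (nhds 0) := lim_tendsto_Y_div hY hu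
  -- the main term
  have hmain : Tendsto (fun x : ℕ => cellDensity j (Real.log x / Real.log (Y x))) atTop
      (nhds (cellDensity j u)) :=
    ((hC.1 j).tendsto (u : ℝ)).comp hv
  -- the error term `C log x / log² Y = C · v · (log Y)⁻¹ → 0`
  have herr : Tendsto (fun x : ℕ => C * Real.log x / Real.log (Y x) ^ 2) atTop (nhds 0) := by
    have h := (hv.mul hM.inv_tendsto_atTop).const_mul C
    rw [mul_zero, mul_zero] at h
    refine h.congr fun x => ?_
    simp only [Pi.inv_apply]
    ring
  -- the secondary term `[j = 0] · (Y/log Y) · log x/x = [j = 0] · v · (Y/x) → 0`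
  have hsec : Tendsto (fun x : ℕ =>
      (if j = 0 then Y x / Real.log (Y x) else 0) * Real.log x / x) atTop (nhds 0) := by
    by_cases hj : j = 0
    · have h := hv.mul hYx
      rw [mul_zero] at h
      refine h.congr fun x => ?_
      rw [if_pos hj]
      ring
    · simp only [if_neg hj, zero_mul, zero_div]
      exact tendsto_const_nhds
  -- the rate bound, multiplied by `log x / x`
  have hkey : ∀ᶠ x : ℕ in atTop,
      |(cell u x (j + 1) : ℝ) * Real.log x / x - (cellDensity j (Real.log x / Real.log (Y x)) -
          (if j = 0 then Y x / Real.log (Y x) else 0) * Real.log x / x)| ≤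
        C * Real.log x / Real.log (Y x) ^ 2 := by
    filter_upwards [eventually_ge_atTop 2] with x hx
    have hx1 : 1 ≤ x := by omega
    have hx0 : (0 : ℝ) < x := by exact_mod_cast (show 0 < x by omega)
    have hL : 0 < Real.log x := Real.log_pos (by exact_mod_cast (show 1 < x by omega))
    have hMx : 0 < Real.log (Y x) := Real.log_pos (by linarith [lim_two_le_Y hY hx1])
    have hRx := hCR (x : ℝ) (Y x) (lim_two_le_Y hY hx1) (lim_Y_le_self hY hu hx) (lim_log_le hY hu0 hx1)
    have hceil : ⌈Y x⌉₊ = ⌊(x : ℝ) ^ ((1 : ℝ) / u)⌋₊ + 1 := by rw [hY, Nat.ceil_natCast]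
    rw [hceil, Nat.floor_natCast, ← cell_eq_omegaCell] at hRx
    have hLx : 0 < Real.log x / x := div_pos hL hx0
    have hident : (cell u x (j + 1) : ℝ) * Real.log x / x - (cellDensity j (Real.log x / Real.log (Y x)) -
        (if j = 0 then Y x / Real.log (Y x) else 0) * Real.log x / x) =
        ((cell u x (j + 1) : ℝ) - ((x : ℝ) * cellDensity j (Real.log x / Real.log (Y x)) / Real.log x -
          (if j = 0 then Y x / Real.log (Y x) else 0))) * (Real.log x / x) := by
      field_simp
    rw [hident, abs_mul, abs_of_pos hLx]
    calc _ ≤ C * x / Real.log (Y x) ^ 2 * (Real.log x / x) := mul_le_mul_of_nonneg_right hRx hLx.le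
      _ = C * Real.log x / Real.log (Y x) ^ 2 := by field_simp
  -- assemble
  have hdiff : Tendsto (fun x : ℕ => (cell u x (j + 1) : ℝ) * Real.log x / x -
      (cellDensity j (Real.log x / Real.log (Y x)) -
        (if j = 0 then Y x / Real.log (Y x) else 0) * Real.log x / x)) atTop (nhds 0) :=
    squeeze_zero_norm' (hkey.mono fun x hx => by rw [Real.norm_eq_abs]; exact hx) herr
  have hfinal := hdiff.add (hmain.sub hsec)
  rw [zero_add, sub_zero] at hfinal
  exact hfinal.congr fun x => by ring

end Summit.Parity.GeneralizedHardyLittlewood.Cruxes.ModelHyperbolicity.WindowChainTransport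

end
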